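import Mathlib.NumberTheory.Chebyshev
import Mathlib.NumberTheory.ArithmeticFunction.Misc
import Literature.NumberTheory.LFunctions.RobinCriterion
import HarnessLib

/-!
# Robin's inequality on `t`-free integers: the Solé–Planat reduction to primorials

Topic: `Literature/NumberTheory/LFunctions`. Pure proof file (one definition: `TFree`). The elementary
half of the method of Solé–Planat (2012), Broughan–Trudgian (2015), Morrill–Platt (2021) and Axler (2023)
for proving Robin's inequality `σ(n) < e^γ n log log n` on the class of `t`-free integers:

* `TFree t n` : `p^t ∤ n` for every prime `p` (CLMS 2007, §1; Solé–Planat 2012, §1).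
* `dedekindFactor t p = ∑_{j<t} p^{-j} = (1 - p^{-t})/(1 - p^{-1})`, the local factor of the
  generalized Dedekind function `Ψ_t(n)/n = ∏_{p ∣ n} (1 - p^{-t})/(1 - p^{-1})` (Solé–Planat 2012, §1).
* `sigma_div_le_prod_dedekindFactor` : for `t`-free `n`, `σ(n)/n ≤ ∏_{p ∣ n} dedekindFactor t p`
  (Solé–Planat 2012, Lemma 2.1 as quoted by Axler 2023: `σ(n) ≤ Ψ_t(n)`).
* `prod_le_prod_primesLE_of_card_le` : exchange lemma — an antitone weight `≥ 1` has a larger product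
  over the first primes than over any set of primes of at most the same size; and its companion
  `primorial_le_prod_of_card_le` (the primorial is the least product of that many distinct primes).
* `robinInequality_of_tFree_of_primorial_bound` : **the reduction** (Solé–Planat 2012, Prop. 2 /
  Lemma 2.2 in Axler's numbering, in the form used by Morrill–Platt 2021, §1: "it is sufficient to
  consider `R_t` only at the primorial numbers"): if `∏_{p ≤ q} dedekindFactor t p < e^γ log θ(q)` for
  every prime `q ≥ x₀` (`x₀` prime) and Robin's inequality holds on `(5040, x₀#)`, then it holds for every
  `t`-free `n > 5040`.

No analytic input is used here; the analytic inequality at primorials and the verified range are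
hypotheses, discharged elsewhere (`RobinTFree24.lean`).

## References
* P. Solé, M. Planat, *The Robin inequality for 7-free integers*, Integers 12 (2012), A65, §2
  (Lemma 2.1 `σ(n) ≤ Ψ_t(n)`, Prop. 2 reduction to primorials). [SolePlanat2012]
* C. Axler, *On Robin's inequality*, Ramanujan J. 61 (2023), §2, Lemmas 2.1–2.2, 2.4. [Axler2023Robin]
* T. Morrill, D. Platt, *Robin's inequality for 20-free integers*, Integers 21 (2021), A28, §1. [MorrillPlatt2021]
* Y. Choie, N. Lichiardopol, P. Moree, P. Solé, *On Robin's criterion for the Riemann hypothesis*,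
  J. Théor. Nombres Bordeaux 19 (2007), 357–372, §1 (t-free), Lemma 7 (monotonicity of the factor). [CLMS2007]
-/

noncomputable section

open Real Finset
open scoped Chebyshev ArithmeticFunction.sigma

namespace Literature.NumberTheory.LFunctions

/-- `n` is `t`-free: no prime `p` has `p^t ∣ n` (so `1` is `t`-free for `t ≥ 1`, and `0` is never
`t`-free). "squarefree" is `2`-free. [cite: CLMS2007, §1 (definition of t-free)] -/
def TFree (t n : ℕ) : Prop := ∀ p : ℕ, p.Prime → ¬ p ^ t ∣ n

namespace RobinTFree

/-- The local factor `∑_{j<t} p^{-j} = 1 + 1/p + ⋯ + 1/p^{t-1} = (1 - p^{-t})/(1 - p^{-1})` of the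
generalized Dedekind function `Ψ_t(n)/n` of Solé–Planat. [cite: SolePlanat2012, §1 (Ψ_t)] -/
def dedekindFactor (t p : ℕ) : ℝ := ∑ j ∈ range t, ((p : ℝ)⁻¹) ^ j

/-- `dedekindFactor t p ≥ 1` for `t ≥ 1`. [folklore] -/
private theorem one_le_dedekindFactor {t : ℕ} (ht : 1 ≤ t) (p : ℕ) : 1 ≤ dedekindFactor t p := by
  unfold dedekindFactor
  have h0 : (1 : ℝ) = ((p : ℝ)⁻¹) ^ 0 := by simp
  calc (1 : ℝ) = ∑ j ∈ range 1, ((p : ℝ)⁻¹) ^ j := by simp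
    _ ≤ ∑ j ∈ range t, ((p : ℝ)⁻¹) ^ j :=
      sum_le_sum_of_subset_of_nonneg (range_mono ht) fun j _ _ => by positivity

/-- `dedekindFactor t p` is positive for `t ≥ 1`. [folklore] -/
private theorem dedekindFactor_pos {t : ℕ} (ht : 1 ≤ t) (p : ℕ) : 0 < dedekindFactor t p :=
  lt_of_lt_of_le one_pos (one_le_dedekindFactor ht p)

/-- `dedekindFactor t p` is nonnegative. [folklore] -/
private theorem dedekindFactor_nonneg (t p : ℕ) : 0 ≤ dedekindFactor t p := by
  unfold dedekindFactor
  exact sum_nonneg fun j _ => by positivity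

/-- The factor is antitone in `p ≥ 1`: `p ≤ r ⟹ dedekindFactor t r ≤ dedekindFactor t p`
(CLMS 2007, Lemma 7 / Remark). [cite: CLMS2007, Lemma 7] -/
theorem dedekindFactor_antitone (t : ℕ) {p r : ℕ} (hp : 1 ≤ p) (hpr : p ≤ r) :
    dedekindFactor t r ≤ dedekindFactor t p := by
  unfold dedekindFactor
  refine sum_le_sum fun j _ => ?_
  have hp' : (0 : ℝ) < p := by exact_mod_cast hp
  have hr' : (p : ℝ) ≤ r := by exact_mod_cast hpr
  exact pow_le_pow_left₀ (by positivity) (inv_anti₀ hp' hr') j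

/-! ### `σ(n)/n ≤ Ψ_t(n)/n` for `t`-free `n` -/

/-- For a prime power `p^k` with `k < t`: `σ(p^k)/p^k = ∑_{j ≤ k} p^{-j} ≤ dedekindFactor t p`.
[cite: SolePlanat2012, Lemma 2.1 (proof)] -/
theorem sigma_prime_pow_div_le {p k t : ℕ} (hp : p.Prime) (hkt : k < t) :
    (σ 1 (p ^ k) : ℝ) / (p : ℝ) ^ k ≤ dedekindFactor t p := by
  have hp0 : (0 : ℝ) < p := by exact_mod_cast hp.pos
  have hpk : (0 : ℝ) < (p : ℝ) ^ k := by positivity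
  rw [ArithmeticFunction.sigma_one_apply_prime_pow hp, Nat.cast_sum, sum_div]
  -- `∑_{i ≤ k} p^i / p^k = ∑_{i ≤ k} (p⁻¹)^(k - i)`; reindex by `i ↦ k - i`
  have hre : ∑ i ∈ range (k + 1), ((p ^ i : ℕ) : ℝ) / (p : ℝ) ^ k
      = ∑ j ∈ range (k + 1), ((p : ℝ)⁻¹) ^ j := by
    rw [← sum_range_reflect]
    refine sum_congr rfl fun j hj => ?_
    have hj' : j ≤ k := Nat.lt_succ_iff.mp (mem_range.mp hj)
    rw [Nat.cast_pow, inv_pow, show k + 1 - 1 - j = k - j by omega, div_eq_iff hpk.ne',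
      inv_mul_eq_div, eq_div_iff (by positivity), ← pow_add, Nat.sub_add_cancel hj']
  rw [hre]
  unfold dedekindFactor
  exact sum_le_sum_of_subset_of_nonneg (range_mono (by omega)) fun j _ _ => by positivity

/-- **Solé–Planat, Lemma 2.1** (`σ(n) ≤ Ψ_t(n)` for `t`-free `n`), divided by `n`:
`σ(n)/n ≤ ∏_{p ∣ n} dedekindFactor t p`. [cite: SolePlanat2012, Lemma 2.1] -/
theorem sigma_div_le_prod_dedekindFactor {t n : ℕ} (hn : n ≠ 0) (htf : TFree t n) :
    (σ 1 n : ℝ) / n ≤ ∏ p ∈ n.primeFactors, dedekindFactor t p := by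
  have hmul := ArithmeticFunction.isMultiplicative_sigma (k := 1)
  have hσ : (σ 1 n : ℝ) = ∏ p ∈ n.primeFactors, (σ 1 (p ^ n.factorization p) : ℝ) := by
    rw [ArithmeticFunction.IsMultiplicative.multiplicative_factorization _ hmul hn, Finsupp.prod,
      Nat.support_factorization, Nat.cast_prod]
  have hnprod : (n : ℝ) = ∏ p ∈ n.primeFactors, (p : ℝ) ^ n.factorization p := by
    conv_lhs => rw [← Nat.prod_factorization_pow_eq_self hn]
    rw [Finsupp.prod, Nat.support_factorization, Nat.cast_prod]
    simp
  rw [hσ, hnprod, ← prod_div_distrib]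
  refine prod_le_prod (fun p _ => by positivity) fun p hp => ?_
  have hpp : p.Prime := Nat.prime_of_mem_primeFactors hp
  refine sigma_prime_pow_div_le hpp ?_
  -- `t`-free: the exponent of `p` is `< t`
  by_contra hge
  push Not at hge
  exact htf p hpp ((Nat.Prime.pow_dvd_iff_le_factorization hpp hn).mpr hge)

/-! ### Exchange lemmas: the first primes are extremal -/

/-- If `S` is a finite set of primes with `#S ≤ π(q)` and `f ≥ 1` is antitone on the primes, then
`∏_{p ∈ S} f p ≤ ∏_{p ≤ q} f p`. [folklore] -/
private theorem prod_le_prod_primesLE_of_card_le {f : ℕ → ℝ} (hf1 : ∀ p : ℕ, p.Prime → 1 ≤ f p)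
    (hanti : ∀ p r : ℕ, p.Prime → r.Prime → p ≤ r → f r ≤ f p)
    {S : Finset ℕ} (hS : ∀ p ∈ S, p.Prime) {q : ℕ} (hcard : S.card ≤ (Nat.primesLE q).card) :
    ∏ p ∈ S, f p ≤ ∏ p ∈ Nat.primesLE q, f p := by
  set Q := Nat.primesLE q with hQ
  have hf0 : ∀ p : ℕ, p.Prime → 0 ≤ f p := fun p hp => zero_le_one.trans (hf1 p hp)
  have hQprime : ∀ r ∈ Q, r.Prime := fun r hr => (Nat.mem_primesLE.1 hr).2
  -- split both products along membership in the other set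
  have hsplitS := prod_filter_mul_prod_filter_not S (fun p => p ∈ Q) f
  have hsplitQ := prod_filter_mul_prod_filter_not Q (fun p => p ∈ S) f
  have hcomm : ∏ p ∈ S.filter (fun p => p ∈ Q), f p = ∏ p ∈ Q.filter (fun p => p ∈ S), f p :=
    prod_congr (by ext p; simp only [mem_filter]; tauto) fun _ _ => rfl
  -- cardinalities of the two "difference" parts
  have hcd : (S.filter fun p => p ∉ Q).card ≤ (Q.filter fun p => p ∉ S).card := by
    have h1 := card_filter_add_card_filter_not (s := S) (fun p => p ∈ Q)
    have h2 := card_filter_add_card_filter_not (s := Q) (fun p => p ∈ S)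
    have h3 : (S.filter fun p => p ∈ Q).card = (Q.filter fun p => p ∈ S).card := by
      congr 1; ext p; simp only [mem_filter]; tauto
    omega
  rw [← hsplitS, ← hsplitQ, hcomm]
  refine mul_le_mul_of_nonneg_left ?_ (prod_nonneg fun p hp => hf0 p (hQprime p (mem_filter.1 hp).1))
  -- the difference parts
  by_cases hempty : (S.filter fun p => p ∉ Q) = ∅
  · rw [hempty, prod_empty]
    exact one_le_prod fun r hr => hf1 r (hQprime r (mem_filter.1 hr).1)
  · have hne : (S.filter fun p => p ∉ Q).Nonempty := nonempty_iff_ne_empty.mpr hempty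
    set m := (S.filter fun p => p ∉ Q).min' hne with hm
    have hmmem : m ∈ S.filter fun p => p ∉ Q := min'_mem _ hne
    have hmprime : m.Prime := hS m (mem_filter.1 hmmem).1
    have hmq : q < m := by
      by_contra hle; push Not at hle
      exact (mem_filter.1 hmmem).2 (Nat.mem_primesLE.2 ⟨hle, hmprime⟩)
    have hc1 : 1 ≤ f m := hf1 m hmprime
    calc ∏ p ∈ S.filter (fun p => p ∉ Q), f p
        ≤ ∏ _p ∈ S.filter (fun p => p ∉ Q), f m :=
          prod_le_prod (fun p hp => hf0 p (hS p (mem_filter.1 hp).1)) fun p hp =>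
            hanti m p hmprime (hS p (mem_filter.1 hp).1) (min'_le _ _ hp)
      _ = (f m) ^ (S.filter fun p => p ∉ Q).card := prod_const _
      _ ≤ (f m) ^ (Q.filter fun p => p ∉ S).card := pow_le_pow_right₀ hc1 hcd
      _ = ∏ _p ∈ Q.filter (fun p => p ∉ S), f m := (prod_const _).symm
      _ ≤ ∏ p ∈ Q.filter (fun p => p ∉ S), f p :=
          prod_le_prod (fun _ _ => zero_le_one.trans hc1) fun r hr => by
            have hr' := Nat.mem_primesLE.1 (mem_filter.1 hr).1
            exact hanti r m hr'.2 hmprime (hr'.1.trans hmq.le)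

/-- The primorial is the least product of a given number of distinct primes: if `S` is a finite set of
primes with `π(q) ≤ #S` then `q# ≤ ∏_{p ∈ S} p`. [folklore] -/
private theorem primorial_le_prod_of_card_le {S : Finset ℕ} (hS : ∀ p ∈ S, p.Prime) {q : ℕ}
    (hcard : (Nat.primesLE q).card ≤ S.card) : primorial q ≤ ∏ p ∈ S, p := by
  set Q := Nat.primesLE q with hQ
  have hprim : primorial q = ∏ p ∈ Q, p := rfl
  have hQprime : ∀ r ∈ Q, r.Prime := fun r hr => (Nat.mem_primesLE.1 hr).2
  have hsplitS := prod_filter_mul_prod_filter_not S (fun p => p ∈ Q) (fun p => p)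
  have hsplitQ := prod_filter_mul_prod_filter_not Q (fun p => p ∈ S) (fun p => p)
  have hcomm : ∏ p ∈ S.filter (fun p => p ∈ Q), p = ∏ p ∈ Q.filter (fun p => p ∈ S), p :=
    prod_congr (by ext p; simp only [mem_filter]; tauto) fun _ _ => rfl
  have hcd : (Q.filter fun p => p ∉ S).card ≤ (S.filter fun p => p ∉ Q).card := by
    have h1 := card_filter_add_card_filter_not (s := S) (fun p => p ∈ Q)
    have h2 := card_filter_add_card_filter_not (s := Q) (fun p => p ∈ S)
    have h3 : (S.filter fun p => p ∈ Q).card = (Q.filter fun p => p ∈ S).card := by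
      congr 1; ext p; simp only [mem_filter]; tauto
    omega
  rw [hprim, ← hsplitS, ← hsplitQ, hcomm]
  refine Nat.mul_le_mul_left _ ?_
  calc ∏ p ∈ Q.filter (fun p => p ∉ S), p
      ≤ ∏ _p ∈ Q.filter (fun p => p ∉ S), (q + 1) :=
        prod_le_prod (fun _ _ => Nat.zero_le _) fun r hr =>
          (Nat.mem_primesLE.1 (mem_filter.1 hr).1).1.trans (Nat.le_succ q)
    _ = (q + 1) ^ (Q.filter fun p => p ∉ S).card := prod_const _
    _ ≤ (q + 1) ^ (S.filter fun p => p ∉ Q).card := Nat.pow_le_pow_right (Nat.succ_pos q) hcd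
    _ = ∏ _p ∈ S.filter (fun p => p ∉ Q), (q + 1) := (prod_const _).symm
    _ ≤ ∏ p ∈ S.filter (fun p => p ∉ Q), p :=
        prod_le_prod (fun _ _ => Nat.zero_le _) fun p hp => by
          have hp' := mem_filter.1 hp
          have hpq : ¬ p ≤ q := fun hle => hp'.2 (Nat.mem_primesLE.2 ⟨hle, hS p hp'.1⟩)
          omega

/-! ### Bracketing `q# ≤ n < q'#` and the bound `ω(n) ≤ π(q)` -/

/-- For `n ≥ 2` there is a largest prime `q` with `q# ≤ n`. [folklore] -/
private theorem exists_max_prime_primorial_le {n : ℕ} (hn : 2 ≤ n) :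
    ∃ q : ℕ, q.Prime ∧ primorial q ≤ n ∧ ∀ r : ℕ, r.Prime → primorial r ≤ n → r ≤ q := by
  classical
  set C := (range (n + 1)).filter (fun m => m.Prime ∧ primorial m ≤ n) with hC
  have h2 : 2 ∈ C := by
    refine mem_filter.2 ⟨mem_range.2 (by omega), Nat.prime_two, ?_⟩
    rw [primorial_two]; exact hn
  have hne : C.Nonempty := ⟨2, h2⟩
  refine ⟨C.max' hne, ?_, ?_, ?_⟩
  · exact (mem_filter.1 (max'_mem C hne)).2.1
  · exact (mem_filter.1 (max'_mem C hne)).2.2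
  · intro r hr hrn
    refine le_max' C r (mem_filter.2 ⟨mem_range.2 ?_, hr, hrn⟩)
    have : r ≤ primorial r := Nat.le_of_dvd (primorial_pos r) (dvd_prod_of_mem _ (by
      exact Nat.mem_primesLE.2 ⟨le_rfl, hr⟩))
    omega

/-- If `q` is the largest prime with `q# ≤ n` (`n ≠ 0`), then `n` has at most `π(q)` prime factors.
[cite: SolePlanat2012, Prop. 2 (proof)] -/
theorem card_primeFactors_le {n q : ℕ} (hn : n ≠ 0)
    (hmax : ∀ r : ℕ, r.Prime → primorial r ≤ n → r ≤ q) :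
    n.primeFactors.card ≤ (Nat.primesLE q).card := by
  by_contra hlt
  push Not at hlt
  -- the next prime after `q`
  obtain ⟨q', hq'⟩ : ∃ q', q < q' ∧ q'.Prime := by
    obtain ⟨q', hge, hp⟩ := Nat.exists_infinite_primes (q + 1)
    exact ⟨q', by omega, hp⟩
  classical
  let q₁ := Nat.find (⟨q', hq'⟩ : ∃ q', q < q' ∧ q'.Prime)
  have hq₁ : q < q₁ ∧ q₁.Prime := Nat.find_spec (⟨q', hq'⟩ : ∃ q', q < q' ∧ q'.Prime)
  have hmin : ∀ m, m < q₁ → ¬ (q < m ∧ m.Prime) := fun m hm => Nat.find_min _ hm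
  have hsub : Nat.primesLE q₁ ⊆ insert q₁ (Nat.primesLE q) := by
    intro p hp
    have hp' := Nat.mem_primesLE.1 hp
    rcases hp'.1.lt_or_eq with hlt' | heq
    · refine mem_insert_of_mem (Nat.mem_primesLE.2 ⟨?_, hp'.2⟩)
      by_contra hpq; push Not at hpq
      exact hmin p hlt' ⟨hpq, hp'.2⟩
    · exact heq ▸ mem_insert_self _ _
  have hcard : (Nat.primesLE q₁).card ≤ n.primeFactors.card :=
    (card_le_card hsub).trans ((card_insert_le _ _).trans (by omega))
  have hle : primorial q₁ ≤ n :=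
    (primorial_le_prod_of_card_le (fun p hp => Nat.prime_of_mem_primeFactors hp) hcard).trans
      (Nat.le_of_dvd (Nat.pos_of_ne_zero hn) (Nat.prod_primeFactors_dvd n))
  have := hmax q₁ hq₁.2 hle
  omega

/-! ### The reduction -/

/-- **Reduction of Robin's inequality on `t`-free integers to an inequality at primorials**
(Solé–Planat 2012, Prop. 2; Morrill–Platt 2021, §1; Axler 2023, proof of Thm 1.2). Let `t ≥ 1` and
`x₀` prime. If `∏_{p ≤ q} (1 + 1/p + ⋯ + 1/p^{t-1}) < e^γ log θ(q)` for every prime `q ≥ x₀`, and Robin's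
inequality holds for `5040 < n < x₀#`, then Robin's inequality holds for every `t`-free `n > 5040`.
Proof: with `q` the largest prime with `q# ≤ n` one has `q ≥ x₀`, `ω(n) ≤ π(q)`,
`σ(n)/n ≤ ∏_{p ∣ n}(…) ≤ ∏_{p ≤ q}(…)` (exchange) and `log θ(q) = log log q# ≤ log log n`.
[cite: SolePlanat2012, Prop. 2] -/
theorem robinInequality_of_tFree_of_primorial_bound {t : ℕ} (ht : 1 ≤ t) {x₀ : ℕ} (hx₀ : x₀.Prime)
    (hanalytic : ∀ q : ℕ, q.Prime → x₀ ≤ q →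
      ∏ p ∈ Nat.primesLE q, dedekindFactor t p < exp eulerMascheroniConstant * Real.log (θ (q : ℝ)))
    (hrange : ∀ n : ℕ, 5040 < n → n < primorial x₀ → robinInequality n) :
    ∀ n : ℕ, 5040 < n → TFree t n → robinInequality n := by
  intro n hn htf
  by_cases hsmall : n < primorial x₀
  · exact hrange n hn hsmall
  push Not at hsmall
  have hn0 : n ≠ 0 := by omega
  have hn2 : 2 ≤ n := by omega
  obtain ⟨q, hq, hqn, hmax⟩ := exists_max_prime_primorial_le hn2
  have hx₀q : x₀ ≤ q := hmax x₀ hx₀ hsmall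
  have hcard := card_primeFactors_le hn0 hmax
  -- σ(n)/n ≤ ∏_{p ≤ q} dedekindFactor t p
  have h1 : (σ 1 n : ℝ) / n ≤ ∏ p ∈ Nat.primesLE q, dedekindFactor t p :=
    (sigma_div_le_prod_dedekindFactor hn0 htf).trans
      (prod_le_prod_primesLE_of_card_le (fun p _ => one_le_dedekindFactor ht p)
        (fun p r hp _ hpr => dedekindFactor_antitone t hp.one_lt.le hpr)
        (fun p hp => Nat.prime_of_mem_primeFactors hp) hcard)
  have h2 := hanalytic q hq hx₀q
  -- log θ(q) = log log q# ≤ log log n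
  have hθ : θ (q : ℝ) = Real.log (primorial q) := by
    rw [Chebyshev.theta_eq_log_primorial, Nat.floor_natCast]
  have hprim2 : (2 : ℝ) ≤ primorial q := by
    have : 2 ≤ primorial q := by
      have h22 : primorial 2 ≤ primorial q := primorial_monotone hq.two_le
      rwa [primorial_two] at h22
    exact_mod_cast this
  have hlogpos : 0 < Real.log (primorial q) := Real.log_pos (by linarith)
  have hloglog : Real.log (θ (q : ℝ)) ≤ Real.log (Real.log n) := by
    rw [hθ]
    refine Real.log_le_log hlogpos (Real.log_le_log (by linarith) (by exact_mod_cast hqn))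
  have hnpos : (0 : ℝ) < n := by exact_mod_cast Nat.pos_of_ne_zero hn0
  have h3 : (σ 1 n : ℝ) / n < exp eulerMascheroniConstant * Real.log (Real.log n) :=
    lt_of_le_of_lt h1 (h2.trans_le (mul_le_mul_of_nonneg_left hloglog (exp_pos _).le))
  unfold robinInequality
  rw [div_lt_iff₀ hnpos] at h3
  linarith

end RobinTFree

end Literature.NumberTheory.LFunctions
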